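import Summits.Schanuel.Schanuel.Theorems.RootDecomp1KHyper19
import Summits.Schanuel.Schanuel.Theorems.RootDecomp1KGeneric19
import Summits.Schanuel.Schanuel.Theorems.RootDecomp1PowerLineOrder02

/-!
# RootDecomp1KFiniteOrderCell — part 01 — PORT NOTE (census-1 gen 14, 2026-08-31): port of HOME/decomp-schanuel-lens-1/g33/RootDecomp1KFiniteOrderCell.lean (sha256 7ddcd064f55911e6…, 1378 l; critic VERDICT STATUS L1611 PORT GO LOW; writer re-check L1612) in four parts; §1 (verbatim copy of the g32 finite-order engine) deleted and imported from `RootDecomp1PowerLineOrder02`; `set_option linter.*` dropped; statements/proofs verbatim; `--supports stmt-Schanuel-33364`; rung 0. The lens's header follows.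
# RootDecomp1K — lens 1 (grading / quantitative ladder), gen 33: «FINITE-ORDER CELL» — item 33364
# (`FiniteOrderLiouvilleSchanuel`, A₄ᵈ) DECIDED on the moment-curve cell of every real of exponential order
# `7n + 3`, WITH AN EXPLICIT CERTIFIED MEMBER AT EVERY LEVEL `n ≥ 2`

Cell decomp-schanuel, seat `decomp-schanuel-lens-1`, gen 33 (2026-08-31); the ONE build sanctioned by the critic
(STATUS L1599 (f)/(g), claim L1602, ACK L1603: «33364 FIRST CELL»).  Route of record `route-Schanuel-RootDecomp1K`
(DRAFT; `closes hL hH hF hB`), item **F** = `FiniteOrderLiouvilleSchanuel` (stmt-Schanuel-33364): Schanuel's bound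
for the `ℚ`-free tuples admitting small integer linear forms to EVERY POLYNOMIAL order but NOT to every
exponential order.  Nothing here proves Schanuel; rung 0.  No 1K decl is restated: the item is cited by NAME in
the probe file (`FOprobe.lean`, `critProbe_F1`: `intro …; exact h33364 …`).

## Content (sorry-free; standard axioms; imports tree Theorems only)

* §1 ENGINE — gen 32 part 2 (`HOME/…/g32/RootDecomp1PowerLineOrder.lean` §5/§5b, critic-verified L1599, port GO
  LOW pending) copied VERBATIM because the farm checks single files: `algebraicIndependent_curvePt_of_liouvilleOrder`
  and `sb_momentCurve_of_liouvilleOrder (hX) (n) (hℓ : LiouvilleOrder (6n+1+n+1+1) ℓ) : SB n (ℓ, ℓ², …, ℓⁿ)`.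
  AT PORT: delete §1 and `import Summits.Schanuel.Schanuel.Theorems.RootDecomp1PowerLineOrder01` instead.
* §2 THE TOWER NUMBERS `T_c := Σ_k 2^{−a_k}`, `a₀ = 1`, `a_{k+1} = 2^{c·a_k}` — lens 6's `λ_H = Σ 2^{−hexp k}`
  (`a_{k+1} = 2^{(k+1)a_k}`, EVERY order) with the growing multiplier `k + 1` FROZEN to the constant `c`.
* §3 ORDER PINNED (hypothesis-free): `liouvilleOrder_towerNumber : LiouvilleOrder k (T_{k+1})`, the effective
  irrationality measure `towerNumber_sub_rat_lower : |T_c − p/q| ≥ 1/(2q·2^{q^c})` (`q ≥ 2`), hence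
  `not_liouvilleOrder_towerNumber : ¬ LiouvilleOrder (c+1) (T_c)` and `not_hyperLiouville_towerNumber` —
  the FIRST explicit reals in the tree of FINITE, PINNED exponential order (`λ_H`: every order; `ℓ_b = Σ b^{−k!}`:
  none); they also witness `HyperLiouville ⊊ LogSqLiouville` (Generic21 left `⊊?`), §6b.
* §4 A DEGREE-`n` NON-MEASURE (hypothesis-free, new): `not_hyperLinLiouville_momentCurve_towerNumber` — for
  `c ≥ n + 1` NO integer form `Σ_{k<n} h_k T_c^{k+1}`, `h ≠ 0`, is smaller than `exp(−(1+Σ|h_k|)^{c+(n+2)(c+1)})`: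
  the truncation `s_i = M/Q_i` at the least scale `Q_i > 4nS` is not a root (2-adic divisibility of the top
  coefficient), `|P(s_i)| ≥ Q_i^{−n}`, and `Q_{i+1} = 2^{Q_i^c} > 4nS·Q_i^n` absorbs the Lipschitz error.
* §5 THE CELL THEOREM `finiteOrderLiouvilleSchanuel_momentCurveCell (hX) (hℓ : LiouvilleOrder (6N+1+N+1+1) ℓ)`:
  item 33364's binders VERBATIM with the single cell line `Set.range z = Set.range (fun i : Fin N => ℓ^(i+1)) →`
  inserted after `LinearIndependent ℚ z` (every level `N`; `_NW` form mod `NesterenkoWaldschmidt1996_thm_5_1`;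
  the union over `ℓ` as one cell line at every level at once: `finiteOrderLiouvilleSchanuel_ordCurveCell`).
* §6 THE MEMBERS `ℓ_F(n) := T_{7n+4}`, `z_F(n) := (ℓ_F(n), …, ℓ_F(n)ⁿ)`: (i) `LiouvilleOrder (6n+1+n+1+1) (ℓ_F n)`
  and `¬ LiouvilleOrder (7n+5)`; (ii) `¬ HyperLiouville (ℓ_F n)`; (iii) BOTH Diophantine hypotheses of 33364
  CERTIFIED at `z_F(n)`, `n ≥ 2`, hypothesis-free (`zF_in_scope_33364`: `LinLiouville` by the tree's
  `linLiouville_momentCurve`, `¬ HyperLinLiouville` by §4 with `c = 7n+4 ≥ n+1`), `ℚ`-free; (iv) the item's text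
  at `z_F(n)` with every hypothesis discharged and the conclusion proved mod `hX`
  (`finiteOrderLiouvilleSchanuel_at_zF`, `_NW`).  §6b: honest placement — level 2's CELL is lens 6's gen-14
  log-square cell (mod NW Thm 1; the member is new), level 3's order-49 sub-cell is lens 6's gen 13; order `24` at
  level 3 and all levels `≥ 4` are new cells of 33364.

## The ladder (the lens; texts)

Item 33364's scope graded by the exponential order `k` of the small forms: grade `k ≥ 7n+3` at level `n` — DECIDED
on the moment curves here (members `T_{7n+4}`); grade `3 ≤ k < 7n+3` — the same engine is silent (it needs
`|ℓ − p/q| < exp(−c_P q^{7n+2})`; the honest parameter count suggests order `2n+1+ε` would do — NOT claimed);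
grade «log-square» — level 2 only (lens 6 gen 14); below («every polynomial order», e.g. `(ℓ_b, ℓ_b²)`) — OPEN,
the catalogued wall (a measure with the heights entering as a sum).  Ceiling of the method family = exponential
order; recorded, not attacked.

Port target (census lane, if cleared): `Summits/Schanuel/Schanuel/Theorems/RootDecomp1KFiniteOrderCell01….lean`
(§2–§6; §1 replaced by the import of gen 32's port), `--supports stmt-Schanuel-33364`.
-/

noncomputable section

open Complex IntermediateField Filter Polynomial

namespace Summit.Schanuel.Schanuel.Theorems.RootDecomp1KFiniteOrderCell

open Summit.Schanuel.Schanuel.Theorems.RootDecomp1KHyper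
open Summit.Schanuel.Schanuel.Theorems.RootDecomp1KHyper.HyperCell
open Summit.Schanuel.Schanuel.Theorems.RootDecomp1KGeneric (LiouvilleOrder LogSqLiouville)
open Literature.NumberTheory.Transcendental (NesterenkoWaldschmidt1996_thm_5_1 NesterenkoWaldschmidt1996_thm_1)
open Summit.Schanuel.Schanuel.Theorems.RootDecomp1PowerLineLadder (sb_momentCurve_of_liouvilleOrder)

variable {n K : ℕ}

-- PORT (census-1 gen 14): §1 of the source (the VERBATIM copy of lens-1 g32 part 2 §5/§5b = the finite-order curve engine) is DELETED here;
-- the engine is imported from the landed port `Summits.Schanuel.Schanuel.Theorems.RootDecomp1PowerLineOrder02` (critic VERDICT STATUS L1611 PORT clause).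

/-! ## §2  The tower numbers `T_c = Σ_k 2^{−a_k}`, `a₀ = 1`, `a_{k+1} = 2^{c·a_k}` -/

/-- The exponent tower with FIXED multiplier `c`: `a₀ = 1`, `a_{k+1} = 2^{c·a_k}`. -/
def texp (c : ℕ) : ℕ → ℕ
  | 0 => 1
  | k + 1 => 2 ^ (c * texp c k)

/-- `texp c 0 = 1` (`a₀ = 1`). -/
@[simp] theorem texp_zero (c : ℕ) : texp c 0 = 1 := rfl

/-- `texp c (k+1) = 2^{c · texp c k}` (`a_{k+1} = 2^{c a_k}`). -/
theorem texp_succ (c k : ℕ) : texp c (k + 1) = 2 ^ (c * texp c k) := rfl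

/-- `1 ≤ texp c k`. -/
theorem one_le_texp (c k : ℕ) : 1 ≤ texp c k := by
  cases k with
  | zero => simp
  | succ k => rw [texp_succ]; exact Nat.one_le_two_pow

/-- The tower exponents are strictly increasing: `texp c k < texp c (k+1)` (for `c ≥ 1`). -/
theorem texp_lt_succ {c : ℕ} (hc : 1 ≤ c) (k : ℕ) : texp c k < texp c (k + 1) := by
  rw [texp_succ]
  calc texp c k < 2 ^ texp c k := Nat.lt_two_pow_self
    _ ≤ 2 ^ (c * texp c k) :=
        Nat.pow_le_pow_right (by norm_num) (Nat.le_mul_of_pos_left _ (by omega))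

/-- `k + 1 ≤ texp c k` (for `c ≥ 1`). -/
theorem succ_le_texp {c : ℕ} (hc : 1 ≤ c) (k : ℕ) : k + 1 ≤ texp c k := by
  induction k with
  | zero => simp
  | succ k ih => exact Nat.succ_le_of_lt (lt_of_le_of_lt ih (texp_lt_succ hc k))

/-- `texp c K + j ≤ texp c (K + j)` (for `c ≥ 1`). -/
theorem texp_add_le {c : ℕ} (hc : 1 ≤ c) (K j : ℕ) : texp c K + j ≤ texp c (K + j) := by
  induction j with
  | zero => simp
  | succ j ih =>
      have := texp_lt_succ hc (K + j)
      show texp c K + (j + 1) ≤ texp c (K + j + 1)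
      omega

/-- `texp c` is strictly monotone (for `c ≥ 1`). -/
theorem texp_strictMono {c : ℕ} (hc : 1 ≤ c) : StrictMono (texp c) :=
  strictMono_nat_of_lt_succ (texp_lt_succ hc)

/-- The denominators `Q_k = 2^{a_k}` satisfy `a_{k+1} = Q_k^c`, i.e. `Q_{k+1} = 2^{Q_k^c}`. -/
theorem texp_succ_eq_pow (c k : ℕ) : texp c (k + 1) = (2 ^ texp c k) ^ c := by
  rw [texp_succ, ← pow_mul, Nat.mul_comm]

/-- **`T_c`** — the tower number `Σ_k 2^{−a_k}` with fixed multiplier `c`. -/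
def towerNumber (c : ℕ) : ℝ := ∑' k, 1 / (2 : ℝ) ^ texp c k

/-- The series `Σ_k 2^{−a_k}` defining the tower number `T_c` is summable. -/
theorem summable_towerNumber {c : ℕ} (hc : 1 ≤ c) : Summable fun k => 1 / (2 : ℝ) ^ texp c k :=
  summable_one_div_pow_of_le (by norm_num) fun k => (Nat.le_succ k).trans (succ_le_texp hc k)

/-- The partial sums: `Σ_{k ≤ K} 2^{−a_k} = M / 2^{a_K}` with `M` ODD. -/
theorem towerNumber_partialSum {c : ℕ} (hc : 1 ≤ c) (K : ℕ) :
    ∃ M : ℕ, Odd M ∧ ∑ k ∈ Finset.range (K + 1), 1 / (2 : ℝ) ^ texp c k = M / (2 : ℝ) ^ texp c K := by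
  induction K with
  | zero => exact ⟨1, odd_one, by simp⟩
  | succ K ih =>
      obtain ⟨M, hM, hsum⟩ := ih
      have hlt := texp_lt_succ hc K
      refine ⟨M * 2 ^ (texp c (K + 1) - texp c K) + 1, ?_, ?_⟩
      · refine Even.add_one (Even.mul_left ?_ _)
        exact (Nat.even_pow' (by omega)).mpr (by decide)
      · rw [Finset.sum_range_succ, hsum]
        have h2 : (2 : ℝ) ^ texp c (K + 1) = 2 ^ texp c K * 2 ^ (texp c (K + 1) - texp c K) := by
          rw [← pow_add, Nat.add_sub_cancel' hlt.le]
        rw [div_add_div _ _ (by positivity) (by positivity), div_eq_div_iff (by positivity)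
          (by positivity)]
        push_cast
        rw [h2]
        ring

/-- The tail `Σ_{k ≥ K} 2^{−a_k}` is positive … -/
theorem towerNumber_tail_pos {c : ℕ} (hc : 1 ≤ c) (K : ℕ) :
    0 < ∑' k, 1 / (2 : ℝ) ^ texp c (k + K) :=
  ((summable_nat_add_iff K).mpr (summable_towerNumber hc)).tsum_pos (fun _ => by positivity) 0
    (by positivity)

/-- … and at most `2 · 2^{−a_K}`. -/
theorem towerNumber_tail_le {c : ℕ} (hc : 1 ≤ c) (K : ℕ) :
    ∑' k, 1 / (2 : ℝ) ^ texp c (k + K) ≤ 2 * (1 / (2 : ℝ) ^ texp c K) := by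
  have hgeom : Summable fun k : ℕ => ((1 : ℝ) / 2) ^ k * (1 / (2 : ℝ) ^ texp c K) :=
    (summable_geometric_two).mul_right _
  calc ∑' k, 1 / (2 : ℝ) ^ texp c (k + K)
        ≤ ∑' k : ℕ, ((1 : ℝ) / 2) ^ k * (1 / (2 : ℝ) ^ texp c K) := by
        refine Summable.tsum_le_tsum (fun k => ?_)
          ((summable_nat_add_iff K).mpr (summable_towerNumber hc)) hgeom
        have hle : texp c K + k ≤ texp c (k + K) := by
          rw [Nat.add_comm k K]; exact texp_add_le hc K k
        rw [one_div_pow, one_div_mul_one_div, ← pow_add, Nat.add_comm k (texp c K)]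
        exact one_div_pow_le_one_div_pow_of_le (by norm_num) hle
    _ = 2 * (1 / (2 : ℝ) ^ texp c K) := by rw [tsum_mul_right, tsum_geometric_two]

/-- … and at least its first term `2^{−a_K}`. -/
theorem towerNumber_tail_ge {c : ℕ} (hc : 1 ≤ c) (K : ℕ) :
    1 / (2 : ℝ) ^ texp c K ≤ ∑' k, 1 / (2 : ℝ) ^ texp c (k + K) := by
  have h := ((summable_nat_add_iff K).mpr (summable_towerNumber hc)).le_tsum 0
    (fun j _ => by positivity)
  simpa using h

/-- `T_c` is its `K`-th partial sum plus its tail. -/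
theorem towerNumber_eq_partialSum_add_tail {c : ℕ} (hc : 1 ≤ c) (K : ℕ) :
    towerNumber c = ∑ k ∈ Finset.range K, 1 / (2 : ℝ) ^ texp c k +
      ∑' k, 1 / (2 : ℝ) ^ texp c (k + K) :=
  ((summable_towerNumber hc).sum_add_tsum_nat_add K).symm

/-- `1/2 < T_c`. -/
theorem half_lt_towerNumber {c : ℕ} (hc : 1 ≤ c) : (1 : ℝ) / 2 < towerNumber c := by
  rw [towerNumber_eq_partialSum_add_tail hc 1]
  have h1 : ∑ k ∈ Finset.range 1, 1 / (2 : ℝ) ^ texp c k = 1 / 2 := by simp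
  rw [h1]
  linarith [towerNumber_tail_pos hc 1]

/-- `T_c < 1` (for `c ≥ 1`: `T_c ≤ 1/2 + 2·2^{−a_1} ≤ 1/2 + 2/4`; we only need `≤ 1`). -/
theorem towerNumber_le_one {c : ℕ} (hc : 1 ≤ c) : towerNumber c ≤ 1 := by
  rw [towerNumber_eq_partialSum_add_tail hc 1]
  have h1 : ∑ k ∈ Finset.range 1, 1 / (2 : ℝ) ^ texp c k = 1 / 2 := by simp
  rw [h1]
  have h2 : ∑' k, 1 / (2 : ℝ) ^ texp c (k + 1) ≤ 2 * (1 / (2 : ℝ) ^ texp c 1) :=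
    towerNumber_tail_le hc 1
  have h3 : (2 : ℝ) ^ 2 ≤ (2 : ℝ) ^ texp c 1 :=
    pow_le_pow_right₀ (by norm_num) (succ_le_texp hc 1)
  have h4 : 2 * (1 / (2 : ℝ) ^ texp c 1) ≤ 2 * (1 / (2 : ℝ) ^ 2) := by
    gcongr
  linarith

/-- The tower number `T_c` is positive. -/
theorem towerNumber_pos {c : ℕ} (hc : 1 ≤ c) : 0 < towerNumber c :=
  lt_trans (by norm_num) (half_lt_towerNumber hc)

/-- The `K`-th truncation as a rational number `M / 2^{a_K}` with odd `M`: its denominator IS `2^{a_K}`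
and its value is the partial sum. -/
theorem towerNumber_truncation {c : ℕ} (hc : 1 ≤ c) (K : ℕ) :
    ∃ r : ℚ, r.den = 2 ^ texp c K ∧
      (r : ℝ) = ∑ k ∈ Finset.range (K + 1), 1 / (2 : ℝ) ^ texp c k := by
  obtain ⟨M, hModd, hsum⟩ := towerNumber_partialSum hc K
  set A : ℕ := texp c K with hA
  set r : ℚ := (M : ℚ) / ((2 : ℚ) ^ A) with hr
  have hden : r.den = 2 ^ A := by
    have hcop : Nat.Coprime (M : ℤ).natAbs ((2 : ℤ) ^ A).natAbs := by
      rw [Int.natAbs_natCast, Int.natAbs_pow]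
      exact Nat.Coprime.pow_right A (Nat.coprime_two_right.mpr hModd)
    have h := Rat.den_div_eq_of_coprime (a := (M : ℤ)) (b := (2 : ℤ) ^ A) (by positivity) hcop
    have e : ((M : ℤ) : ℚ) / (((2 : ℤ) ^ A : ℤ) : ℚ) = r := by rw [hr]; push_cast; rfl
    rw [e] at h
    exact_mod_cast h
  refine ⟨r, hden, ?_⟩
  rw [hsum, hr]; push_cast; rfl

end Summit.Schanuel.Schanuel.Theorems.RootDecomp1KFiniteOrderCell
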